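import Summits.QuantumFields.BalabanUV.T4Continuum.Support.AveragingDeficitFluxExpansion
import Summits.QuantumFields.BalabanUV.T4Continuum.Support.MinimalActionRate
import Summits.QuantumFields.BalabanUV.T4Continuum.Support.SkeletonFillFullSmall
import HarnessLib

/-!
# Route «BalabanUVNodes», crux K3⁷ `SpineGivenEndpointR13SepCoPH` (stmt-QuantumFields-20544) — node N16 = NE3, in-edge N07 → N16:
# PREPARATION for `…N16Thm1AtTorusVPSmallCubes` (the refutation of the displayed N07 in-edge `stub_thm1At`): plaquettes from local
# exponential gauges, and a constant `SU(2)` datum with one plaquette at a prescribed C⋆-distance from `1`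

Cell `pub-ymgap`, seat `pub-ymgap-dag-n16-w2` (WIDTH SEAT 2∕3 on node N16; director-ym №197 ∕ HUMAN RULING D-0149), generation g4, file 1 of 2.
`--kind proof --supports stmt-QuantumFields-20544 --as helper` (count-neutral).  THEOREMS ONLY (0 `def`, 0 `sorry`, standard axioms).

CONTENT (all [folklore] bookkeeping over the tree's objects `B7Prop1Explicit.hol ∕ gaugeAct ∕ plaqWord`, `T4AveragingDeficitWall.SmallField`,
`MinimalActionRate.sfClass`):
* §1 `smallField_of_localGauges` — if a `U(N)`-valued `U` has about EVERY site a unitary gauge in which `U = exp a` on the bonds within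
  `|·|₁ ≤ 2`, `‖a‖ ≤ α₀`, `‖∇a‖ ≤ α₁` within `1` (the (9)_{β₀=1} interface data of the N07 in-edge, WITHOUT the second differences), then
  EVERY plaquette holonomy of `U` is within `2α₁ + ρ(4α₀)` of `1` (`ρ(t) = eᵗ − 1 − t`; `AveragingDeficitFluxExpansion.norm_fhol_sub_one_le`
  + unitary conjugation + `SkeletonFillFullSmall.hol_plaqWord_swap`).  This is the plaquette half of the data that `RegularSupOfGauge.regularSup_of_localGauge`
  takes as a separate `SmallField` hypothesis.
* §2 `exists_constDatum` — for `0 ≤ ε ≤ 2`, directions `i₀ ≠ i₁`, any `(L, N)`: the CONSTANT configuration with the rotation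
  `R = [[c, −s], [s, c]]` (`s = ε∕2`, `c = √(1 − s²)`) on the `i₀`-bonds, `P = diag(i, −i)` on the `i₁`-bonds and `1` elsewhere is
  unitary (indeed `SU(2)`), periodic of every period, lies in `sfClass d L N ε 0`, and its `(i₀, i₁)`-plaquette at the origin is at
  C⋆-distance EXACTLY `ε` from `1` (`R P R⁻¹ P⁻¹ − 1 = (2s) • M`, `M` unitary).

HONEST FRAMING.  Elementary lattice ∕ `2 × 2` matrix bookkeeping; nothing of Bałaban asserted; no `def`, no `sorry`; N16 ∕ N07 NOT
discharged; counts UNMOVED (typed 28∕28 · discharged 5∕27 · A 5∕28); one finite four-torus at fixed ε — R4 closes the conditional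
finite-𝕋⁴ rung `BalabanLadder.UV` only; the YM mass gap (Clay) is NOT proved by any of this; nothing continuum ∕ ℝ⁴ ∕ OS.
-/

set_option autoImplicit false

open scoped BigOperators Matrix Matrix.Norms.L2Operator
open NormedSpace

namespace Summit.QuantumFields.YangMills.BalabanUVNodes.N16Thm1AtTorusVPSmallCubesPrep

open Literature.MathematicalPhysics.QuantumFieldTheory.Balaban1983to89
open B7Prop1Explicit B7Prop2Explicit MatrixLog UnitaryModel
open T4AveragingDeficitWall hiding Site Plane Plaq Bond
open T4AveragingDeficitWallBoundary (IsPeriodicCfg)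
open Summit.QuantumFields.BalabanUV.T4Continuum
open MinimalActionRate (sfClass)
open AveragingDeficitLatticeH2Prep (fd)
open AveragingDeficitTransport (mem_U1_of_unitary)

noncomputable section

variable {d : ℕ}

/-! ## §1 Plaquettes from local exponential gauges -/

section Gauges

variable {n : Type*} [Fintype n] [DecidableEq n] [Nonempty n]

/-- **PLAQUETTES FROM LOCAL EXPONENTIAL GAUGES.**  If a `U(N)`-valued configuration `U` admits, about EVERY site `x`, a unitary
gauge `u` with `U^u(b) = exp a(b)` on the bonds `b = (y, τ)` with `|y − x|₁ ≤ 2`, `‖a(b)‖ ≤ α₀` there and first differences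
`‖∇_i a_τ(y)‖ ≤ α₁` for `|y − x|₁ ≤ 1`, then EVERY unit plaquette holonomy of `U` is within `2α₁ + ρ(4α₀)` of `1`
(`ρ(t) = eᵗ − 1 − t`): the plaquette at `x` in the gauge about `x` is a product of four exponentials whose exponents sum to a
difference of two first differences (`AveragingDeficitFluxExpansion.norm_fhol_sub_one_le`), and conjugation by the unitary
`u(x)` does not change the distance from `1`.  This is the plaquette half of the (9)_{β₀=1} data that
`RegularSupOfGauge.regularSup_of_localGauge` takes as a separate hypothesis. [folklore] -/
theorem smallField_of_localGauges {U : Site d → Fin d → (Matrix n n ℂ)ˣ} (hU : IsUnitaryCfg U) {α₀ α₁ : ℝ}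
    (hgauge : ∀ x : Site d, ∃ (u : Site d → (Matrix n n ℂ)ˣ) (a : Site d → Fin d → Matrix n n ℂ),
      (∀ z, u z ∈ unitaryUnits (Matrix n n ℂ)) ∧
      (∀ (y : Site d) (τ : Fin d), l1 (y - x) ≤ 2 → ((gaugeAct u U y τ : (Matrix n n ℂ)ˣ) : Matrix n n ℂ) = exp (a y τ)) ∧
      (∀ (y : Site d) (τ : Fin d), l1 (y - x) ≤ 2 → ‖a y τ‖ ≤ α₀) ∧
      (∀ (y : Site d) (τ i : Fin d), l1 (y - x) ≤ 1 → ‖fd i (fun z => a z τ) y‖ ≤ α₁)) :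
    SmallField U (2 * α₁ + expRem (4 * α₀)) := by
  -- ordered plaquettes first
  have hlt : ∀ (x : Site d) (κ κ' : Fin d) (h : κ < κ'),
      ‖((hol U x (plaqWord κ κ') : (Matrix n n ℂ)ˣ) : Matrix n n ℂ) - 1‖ ≤ 2 * α₁ + expRem (4 * α₀) := by
    intro x κ κ' h
    obtain ⟨u, a, hu, hexp, h0, h1⟩ := hgauge x
    have hg := (AveragingDeficitFluxExpansion.norm_fhol_sub_one_le (V := gaugeAct u U) hexp h0 h1 κ κ κ' h).1
    have hval : ((fhol (gaugeAct u U) (x, ⟨(κ, κ'), h⟩) : (Matrix n n ℂ)ˣ) : Matrix n n ℂ)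
        = ((u x : (Matrix n n ℂ)ˣ) : Matrix n n ℂ) * ((hol U x (plaqWord κ κ') : (Matrix n n ℂ)ˣ) : Matrix n n ℂ) *
          (((u x)⁻¹ : (Matrix n n ℂ)ˣ) : Matrix n n ℂ) := by
      show ((hol (gaugeAct u U) x (plaqWord κ κ') : (Matrix n n ℂ)ˣ) : Matrix n n ℂ) = _
      rw [hol_gaugeAct_closed _ _ _ _ (disp_plaqWord κ κ'), Units.val_mul, Units.val_mul]
    rw [hval] at hg
    have hconj : ((hol U x (plaqWord κ κ') : (Matrix n n ℂ)ˣ) : Matrix n n ℂ)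
        = (((u x)⁻¹ : (Matrix n n ℂ)ˣ) : Matrix n n ℂ) *
          (((u x : (Matrix n n ℂ)ˣ) : Matrix n n ℂ) * ((hol U x (plaqWord κ κ') : (Matrix n n ℂ)ˣ) : Matrix n n ℂ) *
            (((u x)⁻¹ : (Matrix n n ℂ)ˣ) : Matrix n n ℂ)) * ((u x : (Matrix n n ℂ)ˣ) : Matrix n n ℂ) := by
      rw [← mul_assoc, ← mul_assoc, Units.inv_mul, one_mul, Units.inv_mul_cancel_right]
    rw [hconj]
    exact (norm_units_inv_conj_sub_one_le (mem_U1_of_unitary (hu x)) _).trans hg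
  -- reversed plaquettes: the inverse holonomy of a unitary configuration is no farther from `1`
  intro x κ κ' hne
  rcases lt_or_gt_of_ne hne with h | h
  · exact hlt x κ κ' h
  · rw [SkeletonFillFullSmall.hol_plaqWord_swap]
    have hmem : hol U x (plaqWord κ' κ) ∈ U1 (Matrix n n ℂ) := hol_mem (fun y μ => mem_U1_of_unitary (hU y μ)) _ _
    exact (norm_inv_sub_one_le hmem).trans (hlt x κ' κ h)

end Gauges

/-! ## §2 A constant `SU(2)` datum with one plaquette at a prescribed distance from `1` -/

/-- The holonomy of a CONSTANT configuration `x ↦ A` around the unit plaquette word `(κ, κ′)` is the group commutator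
`A κ · A κ′ · (A κ)⁻¹ · (A κ′)⁻¹`. [folklore] -/
theorem hol_const_plaqWord {G : Type*} [Group G] (A : Fin d → G) (x : Site d) (κ μ : Fin d) :
    hol (fun (_ : Site d) (ν : Fin d) => A ν) x (plaqWord κ μ) = A κ * A μ * (A κ)⁻¹ * (A μ)⁻¹ := by
  simp only [plaqWord, hol_cons, hol_nil, stepHol_true, stepHol_false, mul_one, mul_assoc]

/-- For `c² + s² = 1` the real rotation `R = [[c, −s], [s, c]]` and its transpose are mutually inverse. [folklore] -/
theorem rot_mul_rot_transpose {c s : ℝ} (h : c ^ 2 + s ^ 2 = 1) :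
    !![(c : ℂ), -(s : ℂ); (s : ℂ), (c : ℂ)] * !![(c : ℂ), (s : ℂ); -(s : ℂ), (c : ℂ)] = 1 ∧
    !![(c : ℂ), (s : ℂ); -(s : ℂ), (c : ℂ)] * !![(c : ℂ), -(s : ℂ); (s : ℂ), (c : ℂ)] = 1 := by
  have h' : (c : ℂ) ^ 2 + (s : ℂ) ^ 2 = 1 := by exact_mod_cast h
  constructor <;>
  · ext i j
    fin_cases i <;> fin_cases j <;>
      simp [Matrix.mul_apply, Fin.sum_univ_two] <;> first | linear_combination h' | linear_combination -h' | ring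

/-- The star of the real rotation is its transpose. [folklore] -/
theorem star_rot (c s : ℝ) :
    star !![(c : ℂ), -(s : ℂ); (s : ℂ), (c : ℂ)] = !![(c : ℂ), (s : ℂ); -(s : ℂ), (c : ℂ)] := by
  ext i j
  fin_cases i <;> fin_cases j <;> simp [Matrix.star_apply]

/-- `P = diag(i, −i)`: `star P = diag(−i, i)` and `P · diag(−i, i) = diag(−i, i) · P = 1`. [folklore] -/
theorem diagI_facts :
    star !![Complex.I, 0; 0, -Complex.I] = !![-Complex.I, 0; 0, Complex.I] ∧
    !![Complex.I, 0; 0, -Complex.I] * !![-Complex.I, 0; 0, Complex.I] = (1 : (Matrix (Fin 2) (Fin 2) ℂ)) ∧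
    !![-Complex.I, 0; 0, Complex.I] * !![Complex.I, 0; 0, -Complex.I] = (1 : (Matrix (Fin 2) (Fin 2) ℂ)) := by
  refine ⟨?_, ?_, ?_⟩
  · ext i j
    fin_cases i <;> fin_cases j <;> simp [Matrix.star_apply]
  · ext i j
    fin_cases i <;> fin_cases j <;> simp [Matrix.mul_apply, Fin.sum_univ_two]
  · ext i j
    fin_cases i <;> fin_cases j <;> simp [Matrix.mul_apply, Fin.sum_univ_two]

/-- The commutator identity behind the datum: `R P Rᵀ P⁻¹ − 1 = (2s) • M`, `M = [[−s, −c], [c, −s]]`, for `c² + s² = 1`.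
[folklore] -/
theorem rot_comm_sub_one {c s : ℝ} (h : c ^ 2 + s ^ 2 = 1) :
    !![(c : ℂ), -(s : ℂ); (s : ℂ), (c : ℂ)] * !![Complex.I, 0; 0, -Complex.I] * !![(c : ℂ), (s : ℂ); -(s : ℂ), (c : ℂ)] *
        !![-Complex.I, 0; 0, Complex.I] - 1
      = ((2 * s : ℝ) : ℂ) • !![-(s : ℂ), -(c : ℂ); (c : ℂ), -(s : ℂ)] := by
  ext i j
  fin_cases i <;> fin_cases j <;>
    simp [Complex.ext_iff] <;>
      first | linear_combination h | linear_combination -h | ring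

/-- `M = [[−s, −c], [c, −s]]` is unitary for `c² + s² = 1`. [folklore] -/
theorem emm_mem_unitary {c s : ℝ} (h : c ^ 2 + s ^ 2 = 1) :
    !![-(s : ℂ), -(c : ℂ); (c : ℂ), -(s : ℂ)] ∈ unitary (Matrix (Fin 2) (Fin 2) ℂ) := by
  have h' : (c : ℂ) ^ 2 + (s : ℂ) ^ 2 = 1 := by exact_mod_cast h
  have hstar : star !![-(s : ℂ), -(c : ℂ); (c : ℂ), -(s : ℂ)] = !![-(s : ℂ), (c : ℂ); -(c : ℂ), -(s : ℂ)] := by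
    ext i j
    fin_cases i <;> fin_cases j <;> simp [Matrix.star_apply]
  rw [Unitary.mem_iff, hstar]
  constructor <;>
  · ext i j
    fin_cases i <;> fin_cases j <;>
      simp [Matrix.mul_apply, Fin.sum_univ_two] <;> first | linear_combination h' | linear_combination -h' | ring

/-- Group bookkeeping for the commutators of the constant datum. [folklore] -/
theorem comm_facts {G : Type*} [Group G] (a b : G) :
    (1 : G) * b * (1 : G)⁻¹ * b⁻¹ = 1 ∧ a * 1 * a⁻¹ * (1 : G)⁻¹ = 1 ∧ (a * b * a⁻¹ * b⁻¹)⁻¹ = b * a * b⁻¹ * a⁻¹ := by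
  refine ⟨by group, by group, by group⟩

/-- **A CONSTANT `SU(2)` DATUM WITH ONE PLAQUETTE AT A PRESCRIBED DISTANCE `ε ∈ [0, 2]` FROM `1`.**  For two directions
`i₀ ≠ i₁` put the rotation `R = [[c, −s], [s, c]]` (`s = ε/2`, `c = √(1 − s²)`) on every `i₀`-bond, `P = diag(i, −i)` on every
`i₁`-bond and `1` elsewhere.  The configuration is constant (hence periodic of every period), unitary, every plaquette
holonomy is `1`, `R P R⁻¹ P⁻¹` or its inverse, and `‖R P R⁻¹ P⁻¹ − 1‖ = ‖(2s) • M‖ = 2s = ε` with `M` unitary: so it lies in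
the level-`0` small-field class `sfClass d L N ε 0` of EVERY radius-`ε` name `(L, N)`, and its `(i₀, i₁)`-plaquette is at
distance EXACTLY `ε` from `1`. [folklore] -/
theorem exists_constDatum (L N : ℕ) {i₀ i₁ : Fin d} (h01 : i₀ ≠ i₁) {ε : ℝ} (hε0 : 0 ≤ ε) (hε2 : ε ≤ 2) :
    ∃ V : Site d → Fin d → (Matrix (Fin 2) (Fin 2) ℂ)ˣ, (∀ x y : Site d, V x = V y) ∧ V ∈ sfClass d L N ε 0 ∧
      ‖((hol V 0 (plaqWord i₀ i₁) : (Matrix (Fin 2) (Fin 2) ℂ)ˣ) : (Matrix (Fin 2) (Fin 2) ℂ)) - 1‖ = ε := by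
  -- the angle data `s = ε/2 ∈ [0, 1]`, `c = √(1 − s²)`
  set s : ℝ := ε / 2 with hs
  have hs0 : 0 ≤ s := by positivity
  have hs1 : s ^ 2 ≤ 1 := by
    have : s ≤ 1 := by rw [hs]; linarith
    nlinarith
  set c : ℝ := Real.sqrt (1 - s ^ 2) with hc
  have hcs : c ^ 2 + s ^ 2 = 1 := by
    rw [hc, Real.sq_sqrt (by linarith)]; ring
  -- the two `SU(2)` matrices as units
  obtain ⟨hRR', hR'R⟩ := rot_mul_rot_transpose hcs
  obtain ⟨hstarP, hPP', hP'P⟩ := diagI_facts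
  set Ru : (Matrix (Fin 2) (Fin 2) ℂ)ˣ := ⟨_, _, hRR', hR'R⟩ with hRu_def
  set Pu : (Matrix (Fin 2) (Fin 2) ℂ)ˣ := ⟨_, _, hPP', hP'P⟩ with hPu_def
  have hRu : Ru ∈ unitaryUnits (Matrix (Fin 2) (Fin 2) ℂ) := by
    rw [mem_unitaryUnits, Unitary.mem_iff]
    show star !![(c : ℂ), -(s : ℂ); (s : ℂ), (c : ℂ)] * !![(c : ℂ), -(s : ℂ); (s : ℂ), (c : ℂ)] = 1 ∧
      !![(c : ℂ), -(s : ℂ); (s : ℂ), (c : ℂ)] * star !![(c : ℂ), -(s : ℂ); (s : ℂ), (c : ℂ)] = 1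
    rw [star_rot]; exact ⟨hR'R, hRR'⟩
  have hPu : Pu ∈ unitaryUnits (Matrix (Fin 2) (Fin 2) ℂ) := by
    rw [mem_unitaryUnits, Unitary.mem_iff]
    show star !![Complex.I, 0; 0, -Complex.I] * !![Complex.I, 0; 0, -Complex.I] = 1 ∧
      !![Complex.I, 0; 0, -Complex.I] * star !![Complex.I, 0; 0, -Complex.I] = 1
    rw [hstarP]; exact ⟨hP'P, hPP'⟩
  -- the main plaquette value and its distance from `1`
  have hmain : ‖((Ru * Pu * Ru⁻¹ * Pu⁻¹ : (Matrix (Fin 2) (Fin 2) ℂ)ˣ) : (Matrix (Fin 2) (Fin 2) ℂ)) - 1‖ = ε := by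
    have hval : ((Ru * Pu * Ru⁻¹ * Pu⁻¹ : (Matrix (Fin 2) (Fin 2) ℂ)ˣ) : (Matrix (Fin 2) (Fin 2) ℂ))
        = !![(c : ℂ), -(s : ℂ); (s : ℂ), (c : ℂ)] * !![Complex.I, 0; 0, -Complex.I] * !![(c : ℂ), (s : ℂ); -(s : ℂ), (c : ℂ)] *
          !![-Complex.I, 0; 0, Complex.I] := by
      simp only [Units.val_mul]; rfl
    rw [hval, rot_comm_sub_one hcs, norm_smul, CStarRing.norm_of_mem_unitary (emm_mem_unitary hcs), mul_one,
      Complex.norm_real, Real.norm_eq_abs, abs_of_nonneg (by positivity), hs]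
    ring
  have hcommU : Ru * Pu * Ru⁻¹ * Pu⁻¹ ∈ unitaryUnits (Matrix (Fin 2) (Fin 2) ℂ) :=
    (unitaryUnits (Matrix (Fin 2) (Fin 2) ℂ)).mul_mem ((unitaryUnits (Matrix (Fin 2) (Fin 2) ℂ)).mul_mem ((unitaryUnits (Matrix (Fin 2) (Fin 2) ℂ)).mul_mem hRu hPu) ((unitaryUnits (Matrix (Fin 2) (Fin 2) ℂ)).inv_mem hRu))
      ((unitaryUnits (Matrix (Fin 2) (Fin 2) ℂ)).inv_mem hPu)
  -- the bond assignment and the constant configuration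
  let A : Fin d → (Matrix (Fin 2) (Fin 2) ℂ)ˣ := fun κ => if κ = i₀ then Ru else if κ = i₁ then Pu else 1
  have hA0 : A i₀ = Ru := if_pos rfl
  have hA1 : A i₁ = Pu := by
    show (if i₁ = i₀ then Ru else if i₁ = i₁ then Pu else 1) = Pu
    rw [if_neg (Ne.symm h01), if_pos rfl]
  have hAe : ∀ κ, κ ≠ i₀ → κ ≠ i₁ → A κ = 1 := fun κ h0 h1 => by
    show (if κ = i₀ then Ru else if κ = i₁ then Pu else 1) = 1
    rw [if_neg h0, if_neg h1]
  have hAu : ∀ κ, A κ ∈ unitaryUnits (Matrix (Fin 2) (Fin 2) ℂ) := fun κ => by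
    by_cases h0 : κ = i₀
    · rw [h0, hA0]; exact hRu
    by_cases h1 : κ = i₁
    · rw [h1, hA1]; exact hPu
    rw [hAe κ h0 h1]; exact (unitaryUnits (Matrix (Fin 2) (Fin 2) ℂ)).one_mem
  refine ⟨fun _ κ => A κ, fun _ _ => rfl, ⟨fun _ κ => hAu κ, fun _ _ _ => rfl, ?_⟩, ?_⟩
  · -- every plaquette within `ε` of `1`
    rw [pow_zero, one_pow, div_one]
    intro x κ κ' hne
    rw [hol_const_plaqWord]
    obtain ⟨c1l, c1r, cinv⟩ := comm_facts Ru Pu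
    by_cases hκ0 : κ = i₀
    · subst hκ0
      by_cases hκ'1 : κ' = i₁
      · subst hκ'1; rw [hA0, hA1, hmain]
      · rw [hA0, hAe κ' (Ne.symm hne) hκ'1, (comm_facts Ru (1 : (Matrix (Fin 2) (Fin 2) ℂ)ˣ)).2.1]; simpa using hε0
    by_cases hκ1 : κ = i₁
    · subst hκ1
      by_cases hκ'0 : κ' = i₀
      · subst hκ'0
        rw [hA0, hA1, ← cinv]
        have hU1 : Ru * Pu * Ru⁻¹ * Pu⁻¹ ∈ U1 (Matrix (Fin 2) (Fin 2) ℂ) := mem_U1_of_unitary hcommU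
        exact (norm_inv_sub_one_le hU1).trans hmain.le
      · rw [hA1, hAe κ' hκ'0 (Ne.symm hne), (comm_facts Pu (1 : (Matrix (Fin 2) (Fin 2) ℂ)ˣ)).2.1]; simpa using hε0
    · rw [hAe κ hκ0 hκ1, (comm_facts (1 : (Matrix (Fin 2) (Fin 2) ℂ)ˣ) (A κ')).1]; simpa using hε0
  · -- the `(i₀, i₁)` plaquette at the origin is the main value
    rw [hol_const_plaqWord, hA0, hA1, hmain]

end

end Summit.QuantumFields.YangMills.BalabanUVNodes.N16Thm1AtTorusVPSmallCubesPrep
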